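import Summits.QuantumFields.BalabanUV.T4Continuum.Support.NE7MinimiserLipschitzPrep
import HarnessLib

/-!
# NE7MinimiserLipschitzLetters — FOUR MORE LETTERS FOR THE LIPSCHITZ DEPENDENCE OF `U_k(V)` ON `V`: the sup of a direction on a finite set by its weighted energy,
# the three-piece bondwise estimate of the competitor `(X^{u′})^{u″}` against `U♯`, and the corner values `s·ū` of the competitor fix the datum when `ū` and `s` do

Cell `pub-balaban`, rung (B)+1 sub-cell t4, lineage `b2b-balaban-t4-ne7-p1` (CRUX PROVER NE7 #1 = OWNER of BINDER row NE7), generation 114.  Memo `t4/b2b-balaban-t4-ne7-p1-g114/ROAD-G114.md` §4.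
WHAT ([folklore]; 0 def, 0 sorry).  `norm_le_pow_mul_energyNormW_of_mem`, `three_piece`, `norm_mul_inv_sub_one`, `corner_fix_mul`.
HONEST FRAMING (page 1): bookkeeping; nothing of Bałaban's asserted; NOT NE7, NOT NE3; spine 0∕9; finite T⁴ rung (B)+1 — NOT infinite volume, NOT mass gap, NOT BetaPertH, NOT Clay.
-/

set_option autoImplicit false

open scoped BigOperators Matrix Matrix.Norms.L2Operator
open NormedSpace Finset Set

namespace Summit.QuantumFields.BalabanUV.T4Continuum.NE7MinimiserLipschitzLetters

open Literature.MathematicalPhysics.QuantumFieldTheory.Balaban1983to89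
open B7Prop1Explicit B7Prop2Explicit
open T4AveragingDeficitWall (IsUnitaryCfg dirSq)
open T4AveragingDeficitWallBoundary (periodBox)
open NE3EnergyShapes (IsUnitarySite)
open NE3EnergyWeightedShapes (energyNormW weighted_sqrt_dirSq_le_energyNormW)
open NE7DatumCoordinateStabiliser (inv_mem_unitary)
open NE7MinimiserLipschitzPrep (norm_regauge_sub_le)

noncomputable section

variable {d : ℕ} {n : Type*} [Fintype n] [DecidableEq n]

/-- `‖Z x κ‖ ≤ L^k · energyNormW L k W Z F` for `x ∈ F` (the weight `(L^k)⁻²` sits on `dirSq`). [folklore] -/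
theorem norm_le_pow_mul_energyNormW_of_mem {L : ℕ} (hL : 1 ≤ L) (k : ℕ) (W : Site d → Fin d → (Matrix n n ℂ)ˣ) {F : Finset (Site d)}
    (Z : Site d → Fin d → Matrix n n ℂ) {x : Site d} (hx : x ∈ F) (κ : Fin d) : ‖Z x κ‖ ≤ (L : ℝ) ^ k * energyNormW L k W Z F := by
  have hLk : (0 : ℝ) < (L : ℝ) ^ k := pow_pos (by exact_mod_cast (by omega : 0 < L)) k
  have h1 : ‖Z x κ‖ ^ 2 ≤ dirSq Z F := by
    calc ‖Z x κ‖ ^ 2 ≤ ∑ μ : Fin d, ‖Z x μ‖ ^ 2 := Finset.single_le_sum (f := fun μ => ‖Z x μ‖ ^ 2) (fun _ _ => sq_nonneg _) (Finset.mem_univ κ)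
      _ ≤ ∑ y ∈ F, ∑ μ : Fin d, ‖Z y μ‖ ^ 2 := Finset.single_le_sum (f := fun y => ∑ μ : Fin d, ‖Z y μ‖ ^ 2) (fun _ _ => Finset.sum_nonneg fun _ _ => sq_nonneg _) hx
      _ = dirSq Z F := rfl
  have h2 := weighted_sqrt_dirSq_le_energyNormW hL k W Z F
  have h3 : Real.sqrt (dirSq Z F) ≤ (L : ℝ) ^ k * energyNormW L k W Z F := by
    have := mul_le_mul_of_nonneg_left h2 hLk.le
    rwa [← mul_assoc, mul_inv_cancel₀ hLk.ne', one_mul] at this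
  exact (Real.le_sqrt_of_sq_le h1).trans h3

/-- **THE THREE-PIECE BONDWISE ESTIMATE**: `‖(Z^{u″})(b) − U♯(b)‖ ≤ ‖u″(x) − 1‖ + ‖u″(x+e_κ) − 1‖ + ‖Z(b) − Y(b)‖ + ‖Y(b) − U♯(b)‖` (unitary `u″`, `Z`). [folklore] -/
theorem three_piece [Nonempty n] {u'' : Site d → (Matrix n n ℂ)ˣ} (hu'' : IsUnitarySite u'') {Z : Site d → Fin d → (Matrix n n ℂ)ˣ} (hZ : IsUnitaryCfg Z)
    (Y Us : Site d → Fin d → (Matrix n n ℂ)ˣ) (x : Site d) (κ : Fin d) :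
    ‖((gaugeAct u'' Z x κ : (Matrix n n ℂ)ˣ) : Matrix n n ℂ) - (Us x κ : Matrix n n ℂ)‖
      ≤ ‖(u'' x : Matrix n n ℂ) - 1‖ + ‖(u'' (x + e κ) : Matrix n n ℂ) - 1‖ + ‖(Z x κ : Matrix n n ℂ) - (Y x κ : Matrix n n ℂ)‖
        + ‖(Y x κ : Matrix n n ℂ) - (Us x κ : Matrix n n ℂ)‖ := by
  have T1 : ‖((gaugeAct u'' Z x κ : (Matrix n n ℂ)ˣ) : Matrix n n ℂ) - (Z x κ : Matrix n n ℂ)‖ ≤ ‖(u'' x : Matrix n n ℂ) - 1‖ + ‖(u'' (x + e κ) : Matrix n n ℂ) - 1‖ := by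
    have h := norm_regauge_sub_le (u := u'' x) (hu'' (x + e κ)) (hZ x κ)
    simpa only [gaugeAct, Units.val_mul] using h
  calc ‖((gaugeAct u'' Z x κ : (Matrix n n ℂ)ˣ) : Matrix n n ℂ) - (Us x κ : Matrix n n ℂ)‖
      ≤ ‖((gaugeAct u'' Z x κ : (Matrix n n ℂ)ˣ) : Matrix n n ℂ) - (Z x κ : Matrix n n ℂ)‖ + ‖(Z x κ : Matrix n n ℂ) - (Us x κ : Matrix n n ℂ)‖ :=
        norm_sub_le_norm_sub_add_norm_sub _ _ _
    _ ≤ ‖((gaugeAct u'' Z x κ : (Matrix n n ℂ)ˣ) : Matrix n n ℂ) - (Z x κ : Matrix n n ℂ)‖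
          + (‖(Z x κ : Matrix n n ℂ) - (Y x κ : Matrix n n ℂ)‖ + ‖(Y x κ : Matrix n n ℂ) - (Us x κ : Matrix n n ℂ)‖) := by
        gcongr; exact norm_sub_le_norm_sub_add_norm_sub _ _ _
    _ ≤ _ := by linarith

/-- `‖s·v⁻¹ − 1‖ = ‖v − s‖` for a unitary `v`. [folklore] -/
theorem norm_mul_inv_sub_one [Nonempty n] (s : (Matrix n n ℂ)ˣ) {v : (Matrix n n ℂ)ˣ} (hv : v ∈ unitaryUnits (Matrix n n ℂ)) :
    ‖(s : Matrix n n ℂ) * ((v⁻¹ : (Matrix n n ℂ)ˣ) : Matrix n n ℂ) - 1‖ = ‖(v : Matrix n n ℂ) - (s : Matrix n n ℂ)‖ := by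
  letI : CStarAlgebra (Matrix n n ℂ) := {}
  have e1 : (s : Matrix n n ℂ) * ((v⁻¹ : (Matrix n n ℂ)ˣ) : Matrix n n ℂ) - 1 = ((s : Matrix n n ℂ) - (v : Matrix n n ℂ)) * ((v⁻¹ : (Matrix n n ℂ)ˣ) : Matrix n n ℂ) := by
    rw [sub_mul, Units.mul_inv]
  rw [e1, CStarRing.norm_mul_mem_unitary _ (inv_mem_unitary hv), norm_sub_rev]

/-- If the coarse field `ū` fixes `V₀` and so does `s`, then `z ↦ s(z)·ū(z)` fixes `V₀` (matrix form). [folklore] -/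
theorem corner_fix_mul {s ub : Site d → (Matrix n n ℂ)ˣ} {V₀ : Site d → Fin d → (Matrix n n ℂ)ˣ} (hs : gaugeAct s V₀ = V₀)
    (hub : ∀ (z : Site d) (κ : Fin d), ub z * V₀ z κ * (ub (z + e κ))⁻¹ = V₀ z κ) (z : Site d) (κ : Fin d) :
    ((s z * ub z : (Matrix n n ℂ)ˣ) : Matrix n n ℂ) * (V₀ z κ : Matrix n n ℂ) * (((s (z + e κ) * ub (z + e κ))⁻¹ : (Matrix n n ℂ)ˣ) : Matrix n n ℂ) = V₀ z κ := by
  have hsz : s z * V₀ z κ * (s (z + e κ))⁻¹ = V₀ z κ := congr_fun (congr_fun hs z) κ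
  have e3 : s z * ub z * V₀ z κ * (s (z + e κ) * ub (z + e κ))⁻¹ = V₀ z κ := by
    calc s z * ub z * V₀ z κ * (s (z + e κ) * ub (z + e κ))⁻¹ = s z * (ub z * V₀ z κ * (ub (z + e κ))⁻¹) * (s (z + e κ))⁻¹ := by group
      _ = V₀ z κ := by rw [hub, hsz]
  have h := congrArg (fun v : (Matrix n n ℂ)ˣ => (v : Matrix n n ℂ)) e3
  simpa only [Units.val_mul] using h

end

end Summit.QuantumFields.BalabanUV.T4Continuum.NE7MinimiserLipschitzLetters
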